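import Literature.Analysis.ValidatedNumerics.KroneckerDotProduct
import Literature.Analysis.ValidatedNumerics.MultiPrecisionInterval
import Mathlib.Data.Real.Basic
import HarnessLib

/-!
# Packed ("Kronecker") linear combinations: exact digits, interval enclosures, and tables from intervals

Topic `Literature/Analysis/ValidatedNumerics` (kernel arithmetic for validated numerics; companion of `KroneckerDotProduct`).
This module is the MERGE of two units written and farm-checked together (rh-explicit weil-2 gen10; merged by gen11 to halve the
number of gate proposals): §A `PackedLinearCombination` (exact digit extraction from `Σ_g s_g·packN a_g` under a capacity bound,
and the interval form `abs_lincomb_sub_digits_le` for sign–magnitude scalar boxes × digit tables) and §B `PackedFromIntervals`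
(turning `MI` interval data into digit tables / scalar boxes at a common unit).  The two original module docstrings follow as
section headers.  Everything is proved; standard axioms. [cite: GathenGerhard2013ModernComputerAlgebra, §8.4] [cite: Moore1966, Ch. 3]
-/

/-!
# Kronecker substitution, II: linear combinations of packed tables — exact digits and interval enclosures

Topic `Literature/Analysis/ValidatedNumerics` (kernel-decidable numerics), companion of `KroneckerDotProduct`.

**Exact part** [cite: GathenGerhard2013ModernComputerAlgebra, §8.4], [cite: KnuthTAOCP2, §4.1]: if `A_g = Σ_i a_{g,i} W^i`
are packed natural-number vectors and `s_g` natural scalars, the big-integer linear combination `Σ_g s_g A_g` is the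
packing of the entrywise combination `i ↦ Σ_g s_g a_{g,i}`, and — as long as every such entry is `< W` — its base-`W`
digits ARE those entries.  One scalar×bignum multiplication per term replaces `n` entry multiplications; measured on
the gate farm: 200 combinations of 40 packed vectors of 100 entries (300-bit entries and scalars, 640-bit slots) with all
digits extracted — 8·10⁵ entry products — in ≈ 2 s of kernel time.

* `lincombN ss As = Σ_g ss_g · As_g`; `lincombN_packN` (no side condition); **`lincombN_div_pow_mod`** (digits under
  capacity); `lincomb_cap` (`G·smax·amax < W`); `digit_packN`.

**Interval part** [cite: Rump2006PosDef, §2] (midpoint–radius arithmetic): real scalars `s_g` in sign–magnitude boxes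
`|s_g − σ_g m_g u_S| ≤ r_g u_S`, real tables `α_{g,i}` with natural digits `|α_{g,i} − a_{g,i} u_A| ≤ e_{g,i} u_A`
(tables packed ONCE); then every entry of `x_i = Σ_g s_g α_{g,i}` is enclosed by digits of FOUR natural combinations
`p = Σ_{σ=+} m A`, `q = Σ_{σ=−} m A`, `ρ = Σ r A`, `τ = Σ (m + r) E`:  `|x_i − (p_i − q_i)u_S u_A| ≤ (ρ_i + τ_i)u_S u_A`
— all in `ℕ`, no signed big arithmetic.

* `SBox`, `SBox.smid`, `posMags/negMags/rads/absPlus`; **`abs_lincomb_sub_digits_le`**.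

Elementary and fully proved.
-/
open Finset
open scoped BigOperators

namespace Literature.Analysis.ValidatedNumerics

namespace KroneckerDot

/-! ## The kernel-side function -/

/-- `lincombN [s₀, s₁, …] [A₀, A₁, …] = Σ_g s_g · A_g` (truncating to the shorter list).
[cite: GathenGerhard2013ModernComputerAlgebra, §8.4] -/
def lincombN : List ℕ → List ℕ → ℕ
  | [], _ => 0
  | _ :: _, [] => 0
  | s :: ss, A :: As => s * A + lincombN ss As

/-! ## Semantics -/

/-- `lincombN` as a sum over any range covering both lists. [cite: GathenGerhard2013ModernComputerAlgebra, §8.4] -/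
theorem lincombN_eq_sum : ∀ (ss As : List ℕ) (G : ℕ), ss.length ≤ G → As.length ≤ G →
    lincombN ss As = ∑ g ∈ range G, ss.getD g 0 * As.getD g 0
  | [], As, G, _, _ => by simp [lincombN]
  | _ :: _, [], G, _, _ => by simp [lincombN]
  | s :: ss, A :: As, G, hs, hA => by
      obtain ⟨G, rfl⟩ : ∃ G', G = G' + 1 := ⟨G - 1, by simp at hs; omega⟩
      rw [lincombN, lincombN_eq_sum ss As G (by simpa using hs) (by simpa using hA), Finset.sum_range_succ']
      simp only [List.getD_cons_succ, List.getD_cons_zero, add_comm]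

/-- **A linear combination of packed vectors is the packing of the entrywise combination**:
`Σ_g s_g · packN W a_g = Σ_{i<n} (Σ_g s_g a_{g,i}) W^i` (lengths `≤ n`; no capacity condition for the VALUE).
[cite: GathenGerhard2013ModernComputerAlgebra, §8.4] -/
theorem lincombN_packN (W : ℕ) {n G : ℕ} (ss : List ℕ) (as : List (List ℕ)) (hs : ss.length ≤ G)
    (hG : as.length ≤ G) (hn : ∀ a ∈ as, a.length ≤ n) :
    lincombN ss (as.map (packN W)) = ∑ i ∈ range n, (∑ g ∈ range G, ss.getD g 0 * (as.getD g []).getD i 0) * W ^ i := by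
  rw [lincombN_eq_sum ss _ G hs (by simpa using hG)]
  have hget : ∀ g, (as.map (packN W)).getD g 0 = packN W (as.getD g []) := fun g ↦ by
    rw [show (0 : ℕ) = packN W [] from rfl, List.getD_map]
  simp only [hget]
  -- expand each packing over `range n`
  have hpk : ∀ g ∈ range G, ss.getD g 0 * packN W (as.getD g [])
      = ∑ i ∈ range n, ss.getD g 0 * (as.getD g []).getD i 0 * W ^ i := by
    intro g _
    rw [packN_eq_sum, Finset.mul_sum]
    have hlen : (as.getD g []).length ≤ n := by
      rw [List.getD_eq_getElem?_getD]
      by_cases hg : g < as.length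
      · rw [List.getElem?_eq_getElem hg, Option.getD_some]; exact hn _ (List.getElem_mem hg)
      · rw [List.getElem?_eq_none (not_lt.1 hg), Option.getD_none]; exact Nat.zero_le _
    rw [← Finset.sum_subset (Finset.range_mono hlen) (fun i _ hi ↦ by
      rw [Finset.mem_range, not_lt] at hi
      rw [List.getD_eq_default _ 0 hi, mul_zero, zero_mul])]
    exact Finset.sum_congr rfl fun i _ ↦ by ring
  rw [Finset.sum_congr rfl hpk, Finset.sum_comm]
  exact Finset.sum_congr rfl fun i _ ↦ by rw [Finset.sum_mul]

/-- **Digits of a linear combination of packed vectors.**  If every entrywise combination is `< W` then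
`(Σ_g s_g · packN W a_g) / W^k % W = Σ_g s_g a_{g,k}` (`k < n`). [cite: KnuthTAOCP2, §4.1] -/
theorem lincombN_div_pow_mod (W : ℕ) {n G k : ℕ} (ss : List ℕ) (as : List (List ℕ)) (hs : ss.length ≤ G)
    (hG : as.length ≤ G) (hn : ∀ a ∈ as, a.length ≤ n) (hk : k < n)
    (hcap : ∀ i, ∑ g ∈ range G, ss.getD g 0 * (as.getD g []).getD i 0 < W) :
    lincombN ss (as.map (packN W)) / W ^ k % W = ∑ g ∈ range G, ss.getD g 0 * (as.getD g []).getD k 0 := by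
  have hW : 0 < W := lt_of_le_of_lt (Nat.zero_le _) (hcap 0)
  rw [lincombN_packN W ss as hs hG hn]
  exact sum_div_pow_mod hW _ hcap hk

/-- **Capacity from uniform bounds**: `s_g ≤ smax`, `a_{g,i} ≤ amax`, `G·smax·amax < W` ⇒ every entrywise combination
is `< W`. [cite: GathenGerhard2013ModernComputerAlgebra, §8.4] -/
theorem lincomb_cap {W G smax amax : ℕ} (ss : List ℕ) (as : List (List ℕ))
    (hss : ∀ s ∈ ss, s ≤ smax) (has : ∀ a ∈ as, ∀ x ∈ a, x ≤ amax) (hcap : G * smax * amax < W) (i : ℕ) :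
    ∑ g ∈ range G, ss.getD g 0 * (as.getD g []).getD i 0 < W := by
  refine lt_of_le_of_lt ?_ hcap
  have hterm : ∀ g ∈ range G, ss.getD g 0 * (as.getD g []).getD i 0 ≤ smax * amax := by
    intro g _
    refine Nat.mul_le_mul ?_ ?_
    · rw [List.getD_eq_getElem?_getD]
      by_cases hg : g < ss.length
      · rw [List.getElem?_eq_getElem hg, Option.getD_some]; exact hss _ (List.getElem_mem hg)
      · rw [List.getElem?_eq_none (not_lt.1 hg), Option.getD_none]; exact Nat.zero_le _
    · have hrow : ∀ x ∈ as.getD g [], x ≤ amax := by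
        rw [List.getD_eq_getElem?_getD]
        by_cases hg : g < as.length
        · rw [List.getElem?_eq_getElem hg, Option.getD_some]; exact has _ (List.getElem_mem hg)
        · rw [List.getElem?_eq_none (not_lt.1 hg), Option.getD_none]; simp
      rw [List.getD_eq_getElem?_getD]
      by_cases hi : i < (as.getD g []).length
      · rw [List.getElem?_eq_getElem hi, Option.getD_some]; exact hrow _ (List.getElem_mem hi)
      · rw [List.getElem?_eq_none (not_lt.1 hi), Option.getD_none]; exact Nat.zero_le _
  calc ∑ g ∈ range G, ss.getD g 0 * (as.getD g []).getD i 0 ≤ ∑ g ∈ range G, smax * amax := Finset.sum_le_sum hterm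
    _ = G * smax * amax := by rw [Finset.sum_const, Finset.card_range, smul_eq_mul, mul_assoc]

/-- **Digits of one packed vector**: entries `< W` ⇒ `packN W a / W^k % W = a_k` (`k < #a`). [cite: KnuthTAOCP2, §4.1] -/
theorem digit_packN {W k : ℕ} (a : List ℕ) (ha : ∀ x ∈ a, x < W) (hk : k < a.length) :
    packN W a / W ^ k % W = a.getD k 0 := by
  have hW : 0 < W := lt_of_le_of_lt (Nat.zero_le _) (ha _ (List.getElem_mem hk))
  rw [packN_eq_sum]
  refine sum_div_pow_mod hW _ (fun e ↦ ?_) hk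
  rw [List.getD_eq_getElem?_getD]
  by_cases he : e < a.length
  · rw [List.getElem?_eq_getElem he, Option.getD_some]; exact ha _ (List.getElem_mem he)
  · rw [List.getElem?_eq_none (not_lt.1 he), Option.getD_none]; exact hW

end KroneckerDot

end Literature.Analysis.ValidatedNumerics
open Finset
open scoped BigOperators

namespace Literature.Analysis.ValidatedNumerics

namespace KroneckerDot

/-! ## Scalar boxes and the four coefficient lists -/

/-- A sign–magnitude scalar box: the real `s` satisfies `|s − (±mag)·u| ≤ rad·u`. [cite: Rump2006PosDef, §2] -/
structure SBox where
  /-- sign (`true` = negative midpoint) -/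
  neg : Bool
  /-- magnitude of the midpoint (units `u`) -/
  mag : ℕ
  /-- radius (units `u`) -/
  rad : ℕ

/-- The signed midpoint as an integer. [cite: Rump2006PosDef, §2] -/
def SBox.smid (s : SBox) : ℤ := if s.neg then -(s.mag : ℤ) else s.mag

/-- Magnitudes of the nonnegative midpoints (others `0`). [cite: GathenGerhard2013ModernComputerAlgebra, §8.4] -/
def posMags (ss : List SBox) : List ℕ := ss.map fun s ↦ if s.neg then 0 else s.mag
/-- Magnitudes of the negative midpoints (others `0`). [cite: GathenGerhard2013ModernComputerAlgebra, §8.4] -/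
def negMags (ss : List SBox) : List ℕ := ss.map fun s ↦ if s.neg then s.mag else 0
/-- Radii. [cite: GathenGerhard2013ModernComputerAlgebra, §8.4] -/
def rads (ss : List SBox) : List ℕ := ss.map fun s ↦ s.rad
/-- `mag + rad` (a bound for `|s|/u`). [cite: GathenGerhard2013ModernComputerAlgebra, §8.4] -/
def absPlus (ss : List SBox) : List ℕ := ss.map fun s ↦ s.mag + s.rad

/-! ## Pointwise facts -/

/-- Indexing a mapped scalar list (plumbing). [folklore] -/
private theorem getD_map_sbox (f : SBox → ℕ) (hf : f ⟨false, 0, 0⟩ = 0) (ss : List SBox) (g : ℕ) :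
    (ss.map f).getD g 0 = f (ss.getD g ⟨false, 0, 0⟩) := by
  have h : (ss.map f).getD g 0 = (ss.map f).getD g (f ⟨false, 0, 0⟩) := by rw [hf]
  rw [h, List.getD_map]

/-- `posMags − negMags` is the signed midpoint. [folklore] -/
private theorem pos_sub_neg (ss : List SBox) (g : ℕ) :
    (((posMags ss).getD g 0 : ℕ) : ℤ) - ((negMags ss).getD g 0 : ℕ) = (ss.getD g ⟨false, 0, 0⟩).smid := by
  unfold posMags negMags
  rw [getD_map_sbox _ (by simp) ss g, getD_map_sbox _ (by simp) ss g]
  unfold SBox.smid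
  cases (ss.getD g ⟨false, 0, 0⟩).neg <;> simp

/-- The scalar bound `|s| ≤ (mag + rad)·u`. [cite: Rump2006PosDef, §2] -/
private theorem abs_scalar_le {u : ℝ} (hu : 0 ≤ u) {s : ℝ} {b : SBox} (h : |s - (b.smid : ℝ) * u| ≤ b.rad * u) :
    |s| ≤ ((b.mag + b.rad : ℕ) : ℝ) * u := by
  have hm : |(b.smid : ℝ) * u| ≤ (b.mag : ℝ) * u := by
    rw [abs_mul, abs_of_nonneg hu]
    refine mul_le_mul_of_nonneg_right ?_ hu
    unfold SBox.smid; split_ifs <;> simp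
  calc |s| = |(s - (b.smid : ℝ) * u) + (b.smid : ℝ) * u| := by ring_nf
    _ ≤ |s - (b.smid : ℝ) * u| + |(b.smid : ℝ) * u| := abs_add_le _ _
    _ ≤ b.rad * u + b.mag * u := add_le_add h hm
    _ = ((b.mag + b.rad : ℕ) : ℝ) * u := by push_cast; ring

/-! ## The enclosure -/

/-- **Interval linear combination from packed tables.**  Scalars `s_g` (`g < G`) in sign–magnitude boxes at unit
`u_S`, tables `α_{g,i}` with natural digits `a_{g,i}` and natural radii `e_{g,i}` at unit `u_A`; the four packed
combinations `p = Σ posMags·A`, `q = Σ negMags·A`, `ρ = Σ rads·A`, `τ = Σ absPlus·E` having digit capacity; then for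
every `i < n`:  `|Σ_{g<G} s_g α_{g,i} − (p_i − q_i) u_S u_A| ≤ (ρ_i + τ_i) u_S u_A`.
[cite: Rump2006PosDef, §2] -/
theorem abs_lincomb_sub_digits_le {W n G i : ℕ} {uS uA : ℝ} (huS : 0 ≤ uS) (huA : 0 ≤ uA)
    (ss : List SBox) (as es : List (List ℕ)) (hss : ss.length ≤ G) (has : as.length ≤ G) (hes : es.length ≤ G)
    (hna : ∀ a ∈ as, a.length ≤ n) (hne : ∀ e ∈ es, e.length ≤ n) (hi : i < n)
    (s : ℕ → ℝ) (α : ℕ → ℕ → ℝ)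
    (hs : ∀ g < G, |s g - ((ss.getD g ⟨false, 0, 0⟩).smid : ℝ) * uS| ≤ (ss.getD g ⟨false, 0, 0⟩).rad * uS)
    (hα : ∀ g < G, ∀ k < n, |α g k - ((as.getD g []).getD k 0 : ℝ) * uA| ≤ ((es.getD g []).getD k 0 : ℝ) * uA)
    (hcapP : ∀ k, ∑ g ∈ range G, (posMags ss).getD g 0 * (as.getD g []).getD k 0 < W)
    (hcapQ : ∀ k, ∑ g ∈ range G, (negMags ss).getD g 0 * (as.getD g []).getD k 0 < W)
    (hcapR : ∀ k, ∑ g ∈ range G, (rads ss).getD g 0 * (as.getD g []).getD k 0 < W)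
    (hcapT : ∀ k, ∑ g ∈ range G, (absPlus ss).getD g 0 * (es.getD g []).getD k 0 < W) :
    |(∑ g ∈ range G, s g * α g i)
        - ((((lincombN (posMags ss) (as.map (packN W)) / W ^ i % W : ℕ) : ℝ)
            - ((lincombN (negMags ss) (as.map (packN W)) / W ^ i % W : ℕ) : ℝ)) * (uS * uA))|
      ≤ (((lincombN (rads ss) (as.map (packN W)) / W ^ i % W : ℕ) : ℝ)
          + ((lincombN (absPlus ss) (es.map (packN W)) / W ^ i % W : ℕ) : ℝ)) * (uS * uA) := by
  have hlp : (posMags ss).length ≤ G := by unfold posMags; simpa using hss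
  have hln : (negMags ss).length ≤ G := by unfold negMags; simpa using hss
  have hlr : (rads ss).length ≤ G := by unfold rads; simpa using hss
  have hla : (absPlus ss).length ≤ G := by unfold absPlus; simpa using hss
  rw [lincombN_div_pow_mod W (posMags ss) as hlp has hna hi hcapP,
    lincombN_div_pow_mod W (negMags ss) as hln has hna hi hcapQ,
    lincombN_div_pow_mod W (rads ss) as hlr has hna hi hcapR,
    lincombN_div_pow_mod W (absPlus ss) es hla hes hne hi hcapT]
  -- abbreviations
  set b : ℕ → SBox := fun g ↦ ss.getD g ⟨false, 0, 0⟩ with hb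
  set a : ℕ → ℕ := fun g ↦ (as.getD g []).getD i 0 with ha
  set e : ℕ → ℕ := fun g ↦ (es.getD g []).getD i 0 with he
  -- the signed midpoint combination
  have hmid : (((∑ g ∈ range G, (posMags ss).getD g 0 * (as.getD g []).getD i 0 : ℕ) : ℝ)
      - ((∑ g ∈ range G, (negMags ss).getD g 0 * (as.getD g []).getD i 0 : ℕ) : ℝ))
      = ∑ g ∈ range G, ((b g).smid : ℝ) * (a g : ℝ) := by
    push_cast
    rw [← Finset.sum_sub_distrib]
    refine Finset.sum_congr rfl fun g _ ↦ ?_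
    have := pos_sub_neg ss g
    have e2 : (((posMags ss).getD g 0 : ℕ) : ℝ) - ((negMags ss).getD g 0 : ℕ) = ((b g).smid : ℝ) := by
      rw [hb]; exact_mod_cast this
    rw [← sub_mul, e2]
  have hrads : ((∑ g ∈ range G, (rads ss).getD g 0 * (as.getD g []).getD i 0 : ℕ) : ℝ)
      = ∑ g ∈ range G, ((b g).rad : ℝ) * (a g : ℝ) := by
    push_cast
    refine Finset.sum_congr rfl fun g _ ↦ ?_
    unfold rads; rw [getD_map_sbox _ rfl ss g]
  have habs : ((∑ g ∈ range G, (absPlus ss).getD g 0 * (es.getD g []).getD i 0 : ℕ) : ℝ)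
      = ∑ g ∈ range G, (((b g).mag + (b g).rad : ℕ) : ℝ) * (e g : ℝ) := by
    push_cast
    refine Finset.sum_congr rfl fun g _ ↦ ?_
    unfold absPlus; rw [getD_map_sbox _ rfl ss g]; push_cast; rfl
  rw [hmid, hrads, habs]
  -- termwise estimate
  have hterm : ∀ g ∈ range G, |s g * α g i - ((b g).smid : ℝ) * (a g : ℝ) * (uS * uA)|
      ≤ (((b g).rad : ℝ) * (a g : ℝ) + (((b g).mag + (b g).rad : ℕ) : ℝ) * (e g : ℝ)) * (uS * uA) := by
    intro g hg
    have hg' : g < G := Finset.mem_range.1 hg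
    have h1 := hs g hg'
    have h2 := hα g hg' i hi
    have hsab := abs_scalar_le huS h1
    have ea : 0 ≤ (a g : ℝ) * uA := mul_nonneg (Nat.cast_nonneg _) huA
    -- s α − σ m a uS uA = s (α − a uA) + (a uA)(s − σ m uS)
    have hsplit : s g * α g i - ((b g).smid : ℝ) * (a g : ℝ) * (uS * uA)
        = s g * (α g i - (a g : ℝ) * uA) + ((a g : ℝ) * uA) * (s g - ((b g).smid : ℝ) * uS) := by ring
    rw [hsplit]
    calc |s g * (α g i - (a g : ℝ) * uA) + ((a g : ℝ) * uA) * (s g - ((b g).smid : ℝ) * uS)|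
        ≤ |s g * (α g i - (a g : ℝ) * uA)| + |((a g : ℝ) * uA) * (s g - ((b g).smid : ℝ) * uS)| := abs_add_le _ _
      _ = |s g| * |α g i - (a g : ℝ) * uA| + ((a g : ℝ) * uA) * |s g - ((b g).smid : ℝ) * uS| := by
          rw [abs_mul, abs_mul, abs_of_nonneg ea]
      _ ≤ (((b g).mag + (b g).rad : ℕ) : ℝ) * uS * ((e g : ℝ) * uA) + ((a g : ℝ) * uA) * ((b g).rad * uS) := by
          refine add_le_add (mul_le_mul hsab h2 (abs_nonneg _) (by positivity)) ?_
          exact mul_le_mul_of_nonneg_left h1 ea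
      _ = (((b g).rad : ℝ) * (a g : ℝ) + (((b g).mag + (b g).rad : ℕ) : ℝ) * (e g : ℝ)) * (uS * uA) := by ring
  -- sum up
  have hsum_mid : ∑ g ∈ range G, ((b g).smid : ℝ) * (a g : ℝ) * (uS * uA)
      = (∑ g ∈ range G, ((b g).smid : ℝ) * (a g : ℝ)) * (uS * uA) := by rw [Finset.sum_mul]
  calc |∑ g ∈ range G, s g * α g i - (∑ g ∈ range G, ((b g).smid : ℝ) * (a g : ℝ)) * (uS * uA)|
      = |∑ g ∈ range G, (s g * α g i - ((b g).smid : ℝ) * (a g : ℝ) * (uS * uA))| := by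
        rw [Finset.sum_sub_distrib, hsum_mid]
    _ ≤ ∑ g ∈ range G, |s g * α g i - ((b g).smid : ℝ) * (a g : ℝ) * (uS * uA)| := Finset.abs_sum_le_sum_abs _ _
    _ ≤ ∑ g ∈ range G, (((b g).rad : ℝ) * (a g : ℝ) + (((b g).mag + (b g).rad : ℕ) : ℝ) * (e g : ℝ)) * (uS * uA) :=
        Finset.sum_le_sum hterm
    _ = (∑ g ∈ range G, ((b g).rad : ℝ) * (a g : ℝ) + ∑ g ∈ range G, (((b g).mag + (b g).rad : ℕ) : ℝ) * (e g : ℝ))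
          * (uS * uA) := by rw [← Finset.sum_add_distrib, Finset.sum_mul]

end KroneckerDot

end Literature.Analysis.ValidatedNumerics

/-!
# Kronecker substitution, IV: from the tree's fixed-point intervals (`NumericsMP.MI`) to sign–magnitude boxes and digit tables

Topic `Literature/Analysis/ValidatedNumerics` (kernel-decidable numerics).  The data contract between the tree's interval
engine (`MultiPrecisionInterval`: `MI.mem S x ⟨lo, hi⟩ ↔ lo ≤ x·S ≤ hi`) and the packed primitives of
`PackedLinearCombination` (scalars in `SBox`es `|s − σ·mag·u| ≤ rad·u`, tables as natural digits
`|α − a·u| ≤ e·u`), at the unit `u = 1/(2S)` so that midpoints and radii are integers without rounding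
[cite: Rump2006PosDef, §2] (midpoint–radius form of an interval):

* `SBox.ofMI I` (`smid = lo + hi`, `rad = hi − lo` in units of `1/(2S)`), **`sbox_ofMI`**;
* `digitsOfMI I = ((lo+hi)⁺, (lo+hi)⁻, hi − lo)`, **`digits_ofMI`**: an explicit splitting `x = g⁺ − g⁻` with
  `|g⁺ − a⁺u| ≤ e·u`, `g⁻ = a⁻u` — the form consumed by `abs_lincomb_sub_digits_le` for signed tables — and
  `digits_ofMI_nonneg` for tables of sign-definite quantities (`lo + hi ≥ 0`), and `clampDigitsOfMI`/`clampDigits_ofMI`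
  (one nonnegative digit, valid without a sign test).

Elementary and fully proved.
-/

open scoped BigOperators

namespace Literature.Analysis.ValidatedNumerics

namespace KroneckerDot

open NumericsMP

/-! ## Scalars -/

/-- The sign–magnitude box of an interval at unit `1/(2S)`: midpoint `lo + hi`, radius `hi − lo`. [cite: Rump2006PosDef, §2] -/
def SBox.ofMI (I : MI) : SBox :=
  ⟨decide (I.lo + I.hi < 0), (I.lo + I.hi).natAbs, (I.hi - I.lo).toNat⟩

/-- The signed midpoint of `SBox.ofMI I` is `lo + hi`. [cite: Rump2006PosDef, §2] -/
theorem smid_ofMI (I : MI) : (SBox.ofMI I).smid = I.lo + I.hi := by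
  unfold SBox.ofMI SBox.smid
  by_cases h : I.lo + I.hi < 0
  · simp only [h, decide_true, if_true]
    rw [Int.natCast_natAbs, abs_of_neg h]; ring
  · simp only [h, decide_false]
    rw [Int.natCast_natAbs, abs_of_nonneg (not_lt.1 h)]; rfl

/-- **Interval ⇒ scalar box**: `x ∈ I` at scale `S` (`S > 0`) gives `|x − (lo+hi)·u| ≤ (hi−lo)·u`, `u = 1/(2S)`.
[cite: Rump2006PosDef, §2] -/
theorem sbox_ofMI {S : ℕ} (hS : 0 < S) {x : ℝ} {I : MI} (h : MI.mem S x I) :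
    |x - ((SBox.ofMI I).smid : ℝ) * (1 / (2 * (S : ℝ)))| ≤ ((SBox.ofMI I).rad : ℝ) * (1 / (2 * (S : ℝ))) := by
  obtain ⟨hlo, hhi⟩ := h
  have hS' : (0 : ℝ) < S := by exact_mod_cast hS
  have hrad : (((SBox.ofMI I).rad : ℕ) : ℝ) = (I.hi : ℝ) - I.lo := by
    have hle : I.lo ≤ I.hi := by exact_mod_cast (hlo.trans hhi)
    unfold SBox.ofMI
    simp only
    rw [show (((I.hi - I.lo).toNat : ℕ) : ℝ) = (((I.hi - I.lo).toNat : ℤ) : ℝ) by norm_cast,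
      Int.toNat_of_nonneg (by omega)]
    push_cast; ring
  rw [smid_ofMI, hrad]
  push_cast
  rw [abs_le]
  constructor
  · rw [show -(((I.hi : ℝ) - I.lo) * (1 / (2 * S))) = ((I.lo : ℝ) + I.lo - (I.lo + I.hi)) * (1 / (2 * S)) by ring]
    have : ((I.lo : ℝ) + I.lo) * (1 / (2 * S)) ≤ x := by
      rw [show ((I.lo : ℝ) + I.lo) * (1 / (2 * S)) = I.lo / S by field_simp; ring]
      exact (div_le_iff₀ hS').2 hlo
    nlinarith [this]
  · have : x ≤ ((I.hi : ℝ) + I.hi) * (1 / (2 * S)) := by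
      rw [show ((I.hi : ℝ) + I.hi) * (1 / (2 * S)) = I.hi / S by field_simp; ring]
      exact (le_div_iff₀ hS').2 hhi
    nlinarith [this]

/-! ## Tables -/

/-- The digit triple of an interval at unit `1/(2S)`: `((lo+hi)⁺, (lo+hi)⁻, hi−lo)`. [cite: Rump2006PosDef, §2] -/
def digitsOfMI (I : MI) : ℕ × ℕ × ℕ := ((I.lo + I.hi).toNat, (-(I.lo + I.hi)).toNat, (I.hi - I.lo).toNat)

/-- **Interval ⇒ signed digit table entry**: with `(a⁺, a⁻, e) = digitsOfMI I` and `u = 1/(2S)`, the splitting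
`g⁺ := x − ... ` realises `g⁺ − g⁻ = x`, `|g⁺ − a⁺u| ≤ e·u`, `|g⁻ − a⁻u| ≤ 0·u` (take `g⁻ = a⁻u`).
[cite: Rump2006PosDef, §2] -/
theorem digits_ofMI {S : ℕ} (hS : 0 < S) {x : ℝ} {I : MI} (h : MI.mem S x I) :
    let u : ℝ := 1 / (2 * (S : ℝ))
    let gm : ℝ := ((digitsOfMI I).2.1 : ℝ) * u
    let gp : ℝ := x + gm
    gp - gm = x ∧ |gp - ((digitsOfMI I).1 : ℝ) * u| ≤ ((digitsOfMI I).2.2 : ℝ) * u ∧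
      |gm - ((digitsOfMI I).2.1 : ℝ) * u| ≤ (0 : ℝ) * u := by
  intro u gm gp
  refine ⟨by ring, ?_, by simp [gm]⟩
  have hb := sbox_ofMI hS h
  rw [smid_ofMI] at hb
  have hrad : (((SBox.ofMI I).rad : ℕ) : ℝ) = ((digitsOfMI I).2.2 : ℝ) := rfl
  rw [hrad] at hb
  -- `a⁺ − a⁻ = lo + hi`
  have hsplit : (((digitsOfMI I).1 : ℕ) : ℝ) - ((digitsOfMI I).2.1 : ℕ) = ((I.lo + I.hi : ℤ) : ℝ) := by
    have e : (((I.lo + I.hi).toNat : ℕ) : ℤ) - (((-(I.lo + I.hi)).toNat : ℕ) : ℤ) = I.lo + I.hi := by omega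
    unfold digitsOfMI
    exact_mod_cast e
  have : gp - ((digitsOfMI I).1 : ℝ) * u = x - ((I.lo + I.hi : ℤ) : ℝ) * u := by
    simp only [gp, gm]
    rw [← hsplit]
    ring
  rw [this]
  exact hb

/-- **Interval ⇒ digit table entry, sign-definite case**: if `0 ≤ lo + hi` then with `a = lo + hi`, `e = hi − lo`,
`u = 1/(2S)`: `|x − a·u| ≤ e·u` and the negative digit is `0`. [cite: Rump2006PosDef, §2] -/
theorem digits_ofMI_nonneg {S : ℕ} (hS : 0 < S) {x : ℝ} {I : MI} (h : MI.mem S x I) (hnn : 0 ≤ I.lo + I.hi) :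
    |x - ((digitsOfMI I).1 : ℝ) * (1 / (2 * (S : ℝ)))| ≤ ((digitsOfMI I).2.2 : ℝ) * (1 / (2 * (S : ℝ)))
      ∧ (digitsOfMI I).2.1 = 0 := by
  have hb := sbox_ofMI hS h
  rw [smid_ofMI] at hb
  refine ⟨?_, by unfold digitsOfMI; simp only; omega⟩
  have e : (((digitsOfMI I).1 : ℕ) : ℝ) = ((I.lo + I.hi : ℤ) : ℝ) := by
    unfold digitsOfMI
    exact_mod_cast Int.toNat_of_nonneg hnn
  rw [e]
  exact hb

/-- The CLAMPED digit pair of an interval at unit `1/(2S)`: `a = (lo+hi)⁺`, `e = (hi−lo) + (lo+hi)⁻` — a single nonnegative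
digit table valid without any sign test (for sign-definite quantities the clamp costs nothing). [cite: Rump2006PosDef, §2] -/
def clampDigitsOfMI (I : MI) : ℕ × ℕ := ((I.lo + I.hi).toNat, (I.hi - I.lo).toNat + (-(I.lo + I.hi)).toNat)

/-- **Interval ⇒ one nonnegative digit, always**: `|x − a·u| ≤ e·u` with `(a, e) = clampDigitsOfMI I`, `u = 1/(2S)`.
[cite: Rump2006PosDef, §2] -/
theorem clampDigits_ofMI {S : ℕ} (hS : 0 < S) {x : ℝ} {I : MI} (h : MI.mem S x I) :
    |x - ((clampDigitsOfMI I).1 : ℝ) * (1 / (2 * (S : ℝ)))| ≤ ((clampDigitsOfMI I).2 : ℝ) * (1 / (2 * (S : ℝ))) := by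
  have hb := sbox_ofMI hS h
  rw [smid_ofMI] at hb
  have hrad : (((SBox.ofMI I).rad : ℕ) : ℝ) = (((I.hi - I.lo).toNat : ℕ) : ℝ) := rfl
  rw [hrad] at hb
  have hu : (0 : ℝ) ≤ 1 / (2 * (S : ℝ)) := by positivity
  unfold clampDigitsOfMI
  simp only
  by_cases hnn : 0 ≤ I.lo + I.hi
  · have e1 : (((I.lo + I.hi).toNat : ℕ) : ℝ) = ((I.lo + I.hi : ℤ) : ℝ) := by exact_mod_cast Int.toNat_of_nonneg hnn
    have e2 : (((-(I.lo + I.hi)).toNat : ℕ) : ℝ) = 0 := by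
      rw [show (-(I.lo + I.hi)).toNat = 0 from Int.toNat_eq_zero.2 (by omega)]; simp
    rw [e1]; push_cast; rw [e2, add_zero]
    push_cast at hb
    exact hb
  · rw [not_le] at hnn
    have e1 : (((I.lo + I.hi).toNat : ℕ) : ℝ) = 0 := by
      rw [show (I.lo + I.hi).toNat = 0 from Int.toNat_eq_zero.2 hnn.le]; simp
    have e2 : (((-(I.lo + I.hi)).toNat : ℕ) : ℝ) = -((I.lo + I.hi : ℤ) : ℝ) := by
      have : (((-(I.lo + I.hi)).toNat : ℕ) : ℤ) = -(I.lo + I.hi) := Int.toNat_of_nonneg (by omega)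
      exact_mod_cast this
    rw [e1, zero_mul, sub_zero]
    push_cast
    rw [e2]
    calc |x| = |(x - ((I.lo + I.hi : ℤ) : ℝ) * (1 / (2 * S))) + ((I.lo + I.hi : ℤ) : ℝ) * (1 / (2 * S))| := by ring_nf
      _ ≤ |x - ((I.lo + I.hi : ℤ) : ℝ) * (1 / (2 * S))| + |((I.lo + I.hi : ℤ) : ℝ) * (1 / (2 * S))| := abs_add_le _ _
      _ ≤ (((I.hi - I.lo).toNat : ℕ) : ℝ) * (1 / (2 * S)) + (-((I.lo + I.hi : ℤ) : ℝ)) * (1 / (2 * S)) := by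
          refine add_le_add hb ?_
          rw [abs_mul, abs_of_nonneg hu, abs_of_neg (by exact_mod_cast hnn)]
      _ = ((((I.hi - I.lo).toNat : ℕ) : ℝ) + -((I.lo + I.hi : ℤ) : ℝ)) * (1 / (2 * S)) := by ring

end KroneckerDot

end Literature.Analysis.ValidatedNumerics
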